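import Summits.CriticalPhenomena.SAWScalingLimit.Theses.SAWSpinMonotone
import Summits.CriticalPhenomena.SAWScalingLimit.Theorems.SAWSpinMonotoneArrivalFlatteningSpinChordDefs
import Summits.CriticalPhenomena.SAWScalingLimit.Theorems.NoFoldBound.Negative.SingletonTightness
import Summits.CriticalPhenomena.SAWScalingLimit.Theorems.SAWDefectDecoherenceDefectDecoherenceTmExterior
import Literature.Probability.RandomPlanarGeometry.HexDomainSingleton
import Literature.Probability.RandomPlanarGeometry.HexParafermionSpinShift

/-!
# Disproof of `ArrivalFlattening` — findings (standing disprover, cycle 1)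

Crux stmt-CriticalPhenomena-16770 = `Summit.CriticalPhenomena.SAWScalingLimit.Theses.SAWSpinMonotone.ArrivalFlattening`
((WCLT) of route SAWSpinMonotone): `∀ ε > 0 ∃ R ∀ Λ` simply connected `∀ a ∈ ∂Λ ∀ v ∈ Λ` with the Euclidean
`R`-ball of lattice vertices of `v` inside `Λ`, for all pairwise distinct neighbours `w₀ w₁ w₂` of `v`:
`‖A_v(11/8)‖ ≤ ε ‖A_v(5/8)‖`, `A_v(s) = Σⱼ F_{Λ.erase v}(a, {v,wⱼ}; x_c, s)` (first-arrival spin transform;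
`arrivalTransform` of the line's Defs module). Units: hexagon-centre spacing `1`, honeycomb edge `1/√3`.

VERDICT (cycle 1): NO KILL. The crux is the wall "W" of the sister crux `InteriorFlattening` (stmt-8297) typed
for first arrivals; every cheap attack fails for a structural reason recorded below, and the exact numerics
(this seat's kit job j026734, 219 exact configurations: the sup of `r = ‖A(11/8)‖/‖A(5/8)‖` over roots AND
simply connected far fields falls monotonically `0.609 → 0.322` from depth `1.53` to `4.36`, `≈ 0.90 R^{-0.70}`;
rattack j023283: median `≈ 0.78 R^{-0.59}`) show no amplification by any simply connected far field.
What IS proved here (Lean, sorry-free throughout; §4–§5 numerics are docblocks):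

* §0 READ-BACK. `arrivalFlattening_iff`: the crux is `∀ ε > 0, ∃ R, AtDepth R (‖A(11/8)‖ ≤ ε‖A(5/8)‖)`
  definitionally (`AtDepth`, `arrivalTransform` of `…SpinChordDefs`); `arrivalTransform_swap₁₂/₀₁`: the transform
  is symmetric in the labelling, so the six labellings of the crux state ONE inequality (harmless redundancy).
* §0c SINGLE-PORT ALIAS. `norm_obs_eleven_eighths_eq`: for every domain `Λ'`, boundary root `a` and edge `{v,t}`,
  `‖F(a,{v,t};x,11/8)‖ = ‖F(a,{v,t};x,5/8)‖` (spin dictionary `F(σ-2) = d² F(σ)` of `HexParafermionSpinShift` at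
  `σ = 11/8` plus `F(-σ) = conj F(σ)`, `obs_neg_spin`). Hence flattening is PURE INTERFERENCE between the three
  ports: `portwiseFlattening_iff_vanishing` — the natural strengthening "each port flattens" is equivalent to
  "the 5/8-port values vanish identically beyond some depth", false (`not_portwise_of_lt_one` for `R < 1`;
  numerically every port of every deep configuration carries mass).
* §1 DEPTH IS LOAD-BEARING. `arrivalFlattening_false_without_depth`: delete "the `R`-ball of `v` lies in `Λ`"
  and the statement fails at `ε = 1/2` on the 4-vertex ball `Λ₄ = {V0,U0,N1,N2}` (root `{E0,U0}`, `v = V0`):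
  `Λ₄ ∖ V0` is an independent set, the only walk is `[U0]`, so `‖A(s)‖ = x_c` for EVERY spin. Tightness
  `not_atDepth_of_lt_one`: for every `ε < 1` an admissible `R` is `≥ 1` (the configuration is `R`-deep for
  `R < 1`; rattack's note records the 10-ball one-port tree, `R(ε) ≥ √7/√3 = 1.527…`, not formalised here).
* §2 QUANTIFIER ORDER carries all content: `arrivalFlatteningNonUniform_holds` — `∀ ε ∀ Λ ∀ a ∃ R ∀ v` is
  vacuously TRUE (`R := Σ_w dist(c u, c w)`, `u` the outer end of the root). An `R` depending on `Λ` proves nothing.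
* §4 SIMPLE CONNECTIVITY (mechanism + exact numerics; docblock, no Lean statement — a "without SC" refutation
  needs a witness family at every depth and the pincer observable is not hand-computable): numerically
  load-bearing — the two-corridor PINCER reverses the inequality (`r = 2.23 > 1` at depth `2.08`, amplification
  EXACTLY `cot 15° = 2+√3` over the one-mouth ball); why the naive two-branch (`ΔW = 2π`) interference is EXACTLY
  spin-blind, which branch pairs amplify (`ΔW = ±240°`), and the Galois obstruction to an exact zero
  (`A(5/8) = 0 ⟺ A(11/8) = 0` in ANY domain).
* §5 LINE `spin-chord` (stubs S1 `ThreeSpinChord`, S2 `SpinMonotonePair`, S4 `ThroughMassDecay`; S3 landed):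
  no stub broken. j026734 envelopes (sup / inf over all configurations of depth `≥ D`): S1 `inf K = 1.28 (D ≤ 2.08)
  ↗ 1.63 (D ≥ 3.79)`, chord with `K = 1` holds in 219/219; S2 spin-monotone order violated in 0/219; S4
  `sup ThroughMass/A(0) = 1.19 (1.53), 1.11 (2.08), 0.99 (2.89), 0.95 (3.51), 0.92 (4.36)` `≈ 1.25 D^{-0.22}` —
  decaying slowly, as the predicted `R^{-9/48}`; table in the §5 docblock; `chord_eq_on_Λ₄` (S1 tight with equality).

Census of attacks: read-back · zero-denominator (Galois-impossible) · arithmetic structure of the winding law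
(none: ports cycle the residues mod 3) · depth-drop (KILLED, Lean) · order-swap (VACUOUS, Lean) · portwise
strengthening (FALSE, Lean) · SC-drop (conjecturally false, mechanism + numerics) · far fields: slit-tip roots,
needle obstacles, off-centre deep vertices, balls to depth `4.36` (219 configurations, no amplification; j026734) ·
line stubs S1/S2/S4 (none broken; envelopes above).
-/

noncomputable section

open Literature.Probability.LatticeModels Literature.Probability.RandomPlanarGeometry.SAW
open Summit.CriticalPhenomena.SAWScalingLimit.Theses.SAWSpinMonotone
open Summit.CriticalPhenomena.SAWScalingLimit.Cruxes.ArrivalFlattening.SpinChord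
open Summit.CriticalPhenomena.SAWScalingLimit.Theorems
open Summit.CriticalPhenomena.SAWScalingLimit.Theorems.DefectDecoherence.TipMartingale
  (dist_sq_eq_normSq exterior_preconnected)
open scoped ComplexConjugate

namespace Summit.CriticalPhenomena.SAWScalingLimit.Cruxes.ArrivalFlattening.Disproof

/-! ## §0 Read-back -/

/-- READ-BACK: the crux is `∀ ε > 0, ∃ R, AtDepth R (‖A(11/8)‖ ≤ ε ‖A(5/8)‖)`, definitionally
(`AtDepth`, `arrivalTransform` of the line's Defs module are verbatim the crux's binder block and `let G` sum). [folklore] -/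
theorem arrivalFlattening_iff :
    ArrivalFlattening ↔ ∀ ε : ℝ, 0 < ε → ∃ R : ℝ, AtDepth R (fun Λ a v w₀ w₁ w₂ =>
      ‖arrivalTransform Λ a v w₀ w₁ w₂ (11 / 8)‖ ≤ ε * ‖arrivalTransform Λ a v w₀ w₁ w₂ (5 / 8)‖) :=
  Iff.rfl

/-- The transform is symmetric under swapping the last two ports … [folklore] -/
theorem arrivalTransform_swap₁₂ (Λ : Finset HexVertex) (a : Sym2 HexVertex) (v w₀ w₁ w₂ : HexVertex) (s : ℝ) :
    arrivalTransform Λ a v w₀ w₂ w₁ s = arrivalTransform Λ a v w₀ w₁ w₂ s := by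
  unfold arrivalTransform; ring

/-- … and the first two: the six labellings of the crux are ONE inequality per vertex. [folklore] -/
theorem arrivalTransform_swap₀₁ (Λ : Finset HexVertex) (a : Sym2 HexVertex) (v w₀ w₁ w₂ : HexVertex) (s : ℝ) :
    arrivalTransform Λ a v w₁ w₀ w₂ s = arrivalTransform Λ a v w₀ w₁ w₂ s := by
  unfold arrivalTransform; ring

/-! ## §0c The single-port alias `‖F(11/8)‖ = ‖F(5/8)‖` -/

/-- Reversing the spin conjugates the weight (real fugacity). [folklore] -/
theorem weight_neg_spin {Λ : Finset HexVertex} {a z : Sym2 HexVertex} (γ : HexMidEdgeSAW Λ a z) (x σ : ℝ) :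
    γ.weight x (-σ) = conj (γ.weight x σ) := by
  simp only [HexMidEdgeSAW.weight, map_mul, map_pow, Complex.conj_ofReal, ← Complex.exp_conj, map_neg,
    Complex.conj_I, Complex.ofReal_neg]
  congr 2
  ring

/-- **`F(a, z; x, -σ) = conj F(a, z; x, σ)`** for real fugacity. [folklore] -/
theorem obs_neg_spin (Λ : Finset HexVertex) (a : Sym2 HexVertex) (x σ : ℝ) (z : Sym2 HexVertex) :
    hexParafermionicObservable Λ a x (-σ) z = conj (hexParafermionicObservable Λ a x σ z) := by
  rw [hexParafermionicObservable, hexParafermionicObservable, map_sum]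
  exact Finset.sum_congr rfl fun γ _ => weight_neg_spin γ x σ

/-- **Single-port alias.** For every domain `Λ'`, boundary root `a ∈ ∂Λ'` and lattice edge `{v, t}`:
`‖F(a,{v,t};x,11/8)‖ = ‖F(a,{v,t};x,5/8)‖` — spin `11/8 = 2 - 5/8` is the alias of `-5/8` (spin dictionary
`F(σ - 2) = ((c t - c v)/(c w₁ - c u))² F(σ)`, both edges of length `1/√3`) and `F(-5/8) = conj F(5/8)`.
Consequence: no single mid-edge flattens; `ArrivalFlattening` is a statement about the INTERFERENCE of the
three port values (it is the clockwise Beltrami mode of the first-arrival triple against its sum mode). [folklore] -/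
theorem norm_obs_eleven_eighths_eq {Λ' : Finset HexVertex} {a : Sym2 HexVertex} (ha : a ∈ hexDomainBoundary Λ')
    {v t : HexVertex} (hvt : hexGraph.Adj v t) (x : ℝ) :
    ‖hexParafermionicObservable Λ' a x (11 / 8) s(v, t)‖ = ‖hexParafermionicObservable Λ' a x (5 / 8) s(v, t)‖ := by
  obtain ⟨he, u, w₁, rfl, hw₁, hu⟩ := ha
  have huw : hexGraph.Adj u w₁ := by simpa using he
  have h := hexParafermionicObservable_spin_sub_two (w₁ := w₁) hu hvt x (11 / 8)
  rw [show (11 / 8 : ℝ) - 2 = -(5 / 8) by norm_num, obs_neg_spin] at h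
  have hn := congrArg (fun z : ℂ => ‖z‖) h
  simp only [norm_mul, norm_pow, norm_div, Complex.norm_conj] at hn
  rw [norm_hexCenter_sub_of_adj hvt, norm_hexCenter_sub_of_adj huw, div_self, one_pow, one_mul] at hn
  · exact hn.symm
  · exact inv_ne_zero (Real.sqrt_ne_zero'.2 (by norm_num))

/-- The natural strengthening "each PORT flattens at depth": `∀ ε > 0 ∃ R`, at every admissible `R`-deep
configuration `‖F_{Λ∖v}(a,{v,w₀};11/8)‖ ≤ ε ‖F_{Λ∖v}(a,{v,w₀};5/8)‖`. [folklore] -/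
def PortwiseFlattening : Prop :=
  ∀ ε : ℝ, 0 < ε → ∃ R : ℝ, AtDepth R (fun Λ a v w₀ _ _ =>
    ‖hexParafermionicObservable (Λ.erase v) a hexCriticalFugacity (11 / 8) s(v, w₀)‖ ≤
      ε * ‖hexParafermionicObservable (Λ.erase v) a hexCriticalFugacity (5 / 8) s(v, w₀)‖)

/-- A boundary mid-edge of `Λ` not touching `v` is a boundary mid-edge of `Λ.erase v`. [folklore] -/
theorem mem_boundary_erase {Λ : Finset HexVertex} {a : Sym2 HexVertex} (ha : a ∈ hexDomainBoundary Λ)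
    {v : HexVertex} (hv : v ∉ a) : a ∈ hexDomainBoundary (Λ.erase v) := by
  obtain ⟨he, u, w₁, rfl, hw₁, hu⟩ := ha
  refine ⟨he, u, w₁, rfl, ?_, ?_⟩
  · exact Finset.mem_erase.2 ⟨fun h => hv (h ▸ Sym2.mem_mk_right u w₁), hw₁⟩
  · exact fun h => hu (Finset.mem_of_mem_erase h)

/-- At depth `R ≥ 1/√3` the root does not touch `v` (its outer end lies outside `Λ`, the neighbours of `v` inside). [folklore] -/
theorem not_mem_root_of_deep {Λ : Finset HexVertex} {a : Sym2 HexVertex} (ha : a ∈ hexDomainBoundary Λ)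
    {v : HexVertex} {R : ℝ} (hR : (Real.sqrt 3)⁻¹ ≤ R)
    (hball : ∀ w : HexVertex, dist (hexCenter w) (hexCenter v) ≤ R → w ∈ Λ) : v ∉ a := by
  obtain ⟨he, u, w₁, rfl, hw₁, hu⟩ := ha
  have huw : hexGraph.Adj u w₁ := by simpa using he
  intro hv
  rcases Sym2.mem_iff.1 hv with rfl | rfl
  · exact hu (hball _ (by rw [dist_self]; exact le_trans (by positivity) hR))
  · apply hu; apply hball
    rw [dist_eq_norm, norm_hexCenter_sub_of_adj huw.symm]
    exact hR

/-- **Portwise flattening ⟺ the `5/8`-port values vanish identically beyond some depth** (by the alias, with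
`ε = 1/2`). The right-hand side is false at every depth a ball has been computed (every port carries walks), and
provably false for `R < 1` (`not_portwise_of_lt_one`). [folklore] -/
theorem portwiseFlattening_iff_vanishing :
    PortwiseFlattening ↔ ∃ R : ℝ, AtDepth R (fun Λ a v w₀ _ _ =>
      hexParafermionicObservable (Λ.erase v) a hexCriticalFugacity (5 / 8) s(v, w₀) = 0) := by
  constructor
  · intro h
    obtain ⟨R, hR⟩ := h (1 / 2) (by norm_num)
    refine ⟨max R (Real.sqrt 3)⁻¹, ?_⟩
    intro Λ hΛ a ha v hv hball w₀ w₁ w₂ h₀ h₁ h₂ h₀₁ h₁₂ h₀₂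
    have hball' : ∀ w : HexVertex, dist (hexCenter w) (hexCenter v) ≤ R → w ∈ Λ :=
      fun w hw => hball w (hw.trans (le_max_left _ _))
    have key := hR Λ hΛ a ha v hv hball' w₀ w₁ w₂ h₀ h₁ h₂ h₀₁ h₁₂ h₀₂
    dsimp only at key ⊢
    have ha' : a ∈ hexDomainBoundary (Λ.erase v) :=
      mem_boundary_erase ha (not_mem_root_of_deep ha (le_max_right _ _) hball)
    rw [norm_obs_eleven_eighths_eq ha' h₀] at key
    have h0 : ‖hexParafermionicObservable (Λ.erase v) a hexCriticalFugacity (5 / 8) s(v, w₀)‖ ≤ 0 := by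
      linarith [norm_nonneg (hexParafermionicObservable (Λ.erase v) a hexCriticalFugacity (5 / 8) s(v, w₀))]
    exact norm_eq_zero.1 (le_antisymm h0 (norm_nonneg _))
  · rintro ⟨R, hR⟩ ε hε
    refine ⟨max R (Real.sqrt 3)⁻¹, ?_⟩
    intro Λ hΛ a ha v hv hball w₀ w₁ w₂ h₀ h₁ h₂ h₀₁ h₁₂ h₀₂
    have hball' : ∀ w : HexVertex, dist (hexCenter w) (hexCenter v) ≤ R → w ∈ Λ :=
      fun w hw => hball w (hw.trans (le_max_left _ _))
    have key := hR Λ hΛ a ha v hv hball' w₀ w₁ w₂ h₀ h₁ h₂ h₀₁ h₁₂ h₀₂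
    dsimp only at key ⊢
    have ha' : a ∈ hexDomainBoundary (Λ.erase v) :=
      mem_boundary_erase ha (not_mem_root_of_deep ha (le_max_right _ _) hball)
    rw [norm_obs_eleven_eighths_eq ha' h₀, key, norm_zero, mul_zero]

/-! ## §1 The depth hypothesis is load-bearing: the 4-vertex ball -/

/-- `E0 = (e₀; 0)`, the outer end of the root (a neighbour of `U0` outside the 4-ball). -/
def E0 : HexVertex := ((Pi.single 0 1 : Site 2), (0 : Fin 2))

/-- **The 4-vertex ball** `Λ₄ = B(V0, 1/√3) = {V0, U0, N1, N2}` (`V0 = (0;0)`, `U0 = (0;1)`, `N1 = (-e₀;1)`,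
`N2 = (-e₁;1)`, coordinates of `SingletonTightness`). -/
def Λ₄ : Finset HexVertex :=
  {(((0 : Site 2)), (0 : Fin 2)), (((0 : Site 2)), (1 : Fin 2)), ((-(Pi.single 0 1 : Site 2)), (1 : Fin 2)),
    ((-(Pi.single 1 1 : Site 2)), (1 : Fin 2))}

/-- The punctured ball `Λ₄ ∖ V0 = {U0, N1, N2}`. -/
def D₃ : Finset HexVertex :=
  {(((0 : Site 2)), (1 : Fin 2)), ((-(Pi.single 0 1 : Site 2)), (1 : Fin 2)), ((-(Pi.single 1 1 : Site 2)), (1 : Fin 2))}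

/-- `U0 ~ E0`. -/
theorem adj_U0_E0 : hexGraph.Adj (((0 : Site 2)), (1 : Fin 2)) E0 := by
  rw [E0, hexGraph.adj_comm, hexGraph_adj_iff_coord]; simp
/-- `E0 ≠ V0`. -/
theorem E0_ne_V0 : E0 ≠ (((0 : Site 2)), (0 : Fin 2)) := by
  intro h; have := congrArg (fun v : HexVertex => v.1 0) h; simp [E0] at this
/-- `E0 ≠ U0`. -/
theorem E0_ne_U0 : E0 ≠ (((0 : Site 2)), (1 : Fin 2)) := by
  intro h; have := congrArg (fun v : HexVertex => v.2) h; simp [E0] at this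
/-- `E0 ≠ N1`. -/
theorem E0_ne_N1 : E0 ≠ ((-(Pi.single 0 1 : Site 2)), (1 : Fin 2)) := by
  intro h; have := congrArg (fun v : HexVertex => v.2) h; simp [E0] at this
/-- `E0 ≠ N2`. -/
theorem E0_ne_N2 : E0 ≠ ((-(Pi.single 1 1 : Site 2)), (1 : Fin 2)) := by
  intro h; have := congrArg (fun v : HexVertex => v.2) h; simp [E0] at this
/-- `V0 ≠ N1`. -/
theorem V0_ne_N1 : (((0 : Site 2)), (0 : Fin 2)) ≠ ((-(Pi.single 0 1 : Site 2)), (1 : Fin 2)) := by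
  intro h; have := congrArg (fun v : HexVertex => v.2) h; simp at this
/-- `V0 ≠ N2`. -/
theorem V0_ne_N2 : (((0 : Site 2)), (0 : Fin 2)) ≠ ((-(Pi.single 1 1 : Site 2)), (1 : Fin 2)) := by
  intro h; have := congrArg (fun v : HexVertex => v.2) h; simp at this

/-- `V0 ∉ D₃`. -/
theorem V0_notMem_D₃ : (((0 : Site 2)), (0 : Fin 2)) ∉ D₃ := by
  simp only [D₃, Finset.mem_insert, Finset.mem_singleton, not_or]
  exact ⟨nfb_U0_ne_V0.symm, V0_ne_N1, V0_ne_N2⟩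

/-- `Λ₄ ∖ V0 = D₃`. -/
theorem erase_V0 : Λ₄.erase (((0 : Site 2)), (0 : Fin 2)) = D₃ := by
  show (insert (((0 : Site 2)), (0 : Fin 2)) D₃ : Finset HexVertex).erase _ = D₃
  exact Finset.erase_insert V0_notMem_D₃

/-- `E0 ∉ Λ₄`. -/
theorem E0_notMem_Λ₄ : E0 ∉ Λ₄ := by
  simp only [Λ₄, Finset.mem_insert, Finset.mem_singleton, not_or]
  exact ⟨E0_ne_V0, E0_ne_U0, E0_ne_N1, E0_ne_N2⟩

/-- `E0 ∉ D₃`. -/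
theorem E0_notMem_D₃ : E0 ∉ D₃ := by
  simp only [D₃, Finset.mem_insert, Finset.mem_singleton, not_or]
  exact ⟨E0_ne_U0, E0_ne_N1, E0_ne_N2⟩

/-- The root `a = {E0, U0}` is a boundary mid-edge of `Λ₄`. -/
theorem root_mem_boundary : s(E0, (((0 : Site 2)), (1 : Fin 2))) ∈ hexDomainBoundary Λ₄ :=
  ⟨(SimpleGraph.mem_edgeSet hexGraph).2 adj_U0_E0.symm, E0, _, rfl, by simp [Λ₄], E0_notMem_Λ₄⟩

/-- `D₃` is an independent set: its three vertices are down-faces. -/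
theorem not_adj_of_mem_D₃ {p q : HexVertex} (hp : p ∈ D₃) (hq : q ∈ D₃) : ¬ hexGraph.Adj p q := by
  simp only [D₃, Finset.mem_insert, Finset.mem_singleton] at hp hq
  apply not_hexGraph_adj_of_snd_eq_holds
  rcases hp with rfl | rfl | rfl <;> rcases hq with rfl | rfl | rfl <;> rfl

/-- **Classification**: every walk of `D₃` from the root to a mid-edge `z ≠ a` is the one-step walk `[U0]`. -/
theorem verts_eq_U0 {z : Sym2 HexVertex} (hz : z ≠ s(E0, (((0 : Site 2)), (1 : Fin 2))))
    (γ : HexMidEdgeSAW D₃ s(E0, (((0 : Site 2)), (1 : Fin 2))) z) : γ.verts = [(((0 : Site 2)), (1 : Fin 2))] := by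
  rcases h : γ.verts with _ | ⟨p, l⟩
  · exact absurd (γ.eq_of_nil h).symm hz
  · have hp : p ∈ D₃ := γ.subset p (by simp [h])
    have hpa : p ∈ s(E0, (((0 : Site 2)), (1 : Fin 2))) := γ.head_mem p (by simp [h])
    have hpU : p = (((0 : Site 2)), (1 : Fin 2)) := by
      rcases Sym2.mem_iff.1 hpa with rfl | rfl
      · exact absurd hp E0_notMem_D₃
      · rfl
    subst hpU
    rcases l with _ | ⟨q, l'⟩
    · rfl
    · exfalso
      have hq : q ∈ D₃ := γ.subset q (by simp [h])
      have hc := γ.isChain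
      rw [h] at hc
      have hadj : hexGraph.Adj (((0 : Site 2)), (1 : Fin 2)) q := (List.isChain_cons_cons.1 hc).1
      exact not_adj_of_mem_D₃ (by simp [D₃]) hq hadj

/-- The one-step walk `[U0]` from the root to the port `{V0, U0}`. -/
def γ₀ : HexMidEdgeSAW D₃ s(E0, (((0 : Site 2)), (1 : Fin 2))) s((((0 : Site 2)), (0 : Fin 2)), (((0 : Site 2)), (1 : Fin 2))) where
  verts := [(((0 : Site 2)), (1 : Fin 2))]
  subset := by simp [D₃]
  nodup := List.nodup_singleton _
  isChain := List.IsChain.singleton _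
  head_mem := by simp
  getLast_mem := by simp
  eq_of_nil := by simp
  edges_nodup := fun _ => by
    have hne : s(E0, (((0 : Site 2)), (1 : Fin 2))) ≠ s((((0 : Site 2)), (0 : Fin 2)), (((0 : Site 2)), (1 : Fin 2))) := by
      rw [Ne, Sym2.eq_iff]
      rintro (⟨h1, -⟩ | ⟨-, h2⟩)
      · exact E0_ne_V0 h1
      · exact nfb_U0_ne_V0 h2
    simp [hne]
  fst_mem := ⟨(SimpleGraph.mem_edgeSet hexGraph).2 adj_U0_E0.symm, _, Sym2.mem_mk_right _ _, by simp [D₃]⟩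

/-- **Port `U0` carries exactly the walk `[U0]`**: `F_{D₃}(a, {V0,U0}; x, s) = weight([U0])`. -/
theorem obs_port_U0 (x s : ℝ) :
    hexParafermionicObservable D₃ s(E0, (((0 : Site 2)), (1 : Fin 2))) x s
        s((((0 : Site 2)), (0 : Fin 2)), (((0 : Site 2)), (1 : Fin 2))) = γ₀.weight x s := by
  have hz : s((((0 : Site 2)), (0 : Fin 2)), (((0 : Site 2)), (1 : Fin 2))) ≠ s(E0, (((0 : Site 2)), (1 : Fin 2))) := by
    rw [Ne, Sym2.eq_iff]
    rintro (⟨h1, -⟩ | ⟨h1, -⟩)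
    · exact E0_ne_V0 h1.symm
    · exact nfb_U0_ne_V0 h1.symm
  letI : Unique (HexMidEdgeSAW D₃ s(E0, (((0 : Site 2)), (1 : Fin 2)))
      s((((0 : Site 2)), (0 : Fin 2)), (((0 : Site 2)), (1 : Fin 2)))) :=
    ⟨⟨γ₀⟩, fun γ => HexMidEdgeSAW.ext (by rw [verts_eq_U0 hz γ]; rfl)⟩
  rw [hexParafermionicObservable, Fintype.sum_unique]
  rfl

/-- **The two other ports carry no walk**: `F_{D₃}(a, {V0, n}; x, s) = 0` for `n ∈ {N1, N2}` (the last vertex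
of `[U0]` is not on `{V0, n}`). -/
theorem obs_port_other {n : HexVertex} (hnV : n ≠ (((0 : Site 2)), (1 : Fin 2))) (hnE : n ≠ E0) (x s : ℝ) :
    hexParafermionicObservable D₃ s(E0, (((0 : Site 2)), (1 : Fin 2))) x s s((((0 : Site 2)), (0 : Fin 2)), n) = 0 := by
  have hz : s((((0 : Site 2)), (0 : Fin 2)), n) ≠ s(E0, (((0 : Site 2)), (1 : Fin 2))) := by
    rw [Ne, Sym2.eq_iff]
    rintro (⟨h1, -⟩ | ⟨-, h2⟩)
    · exact E0_ne_V0 h1.symm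
    · exact hnE h2
  haveI : IsEmpty (HexMidEdgeSAW D₃ s(E0, (((0 : Site 2)), (1 : Fin 2))) s((((0 : Site 2)), (0 : Fin 2)), n)) := by
    refine ⟨fun γ => ?_⟩
    have hv := verts_eq_U0 hz γ
    have hl := γ.getLast_mem (((0 : Site 2)), (1 : Fin 2)) (by rw [hv]; rfl)
    rcases Sym2.mem_iff.1 hl with h | h
    · exact nfb_U0_ne_V0 h
    · exact hnV h.symm
  simp [hexParafermionicObservable]

/-- **The first-arrival transform of the witness is one unimodular term**: `‖A(s)‖ = x_c` for every spin `s`. -/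
theorem norm_arrivalTransform_Λ₄ (s : ℝ) :
    ‖arrivalTransform Λ₄ s(E0, (((0 : Site 2)), (1 : Fin 2))) (((0 : Site 2)), (0 : Fin 2))
        (((0 : Site 2)), (1 : Fin 2)) ((-(Pi.single 0 1 : Site 2)), (1 : Fin 2)) ((-(Pi.single 1 1 : Site 2)), (1 : Fin 2)) s‖ =
      hexCriticalFugacity := by
  rw [arrivalTransform, erase_V0, obs_port_U0, obs_port_other nfb_U0_ne_N1.symm E0_ne_N1.symm,
    obs_port_other nfb_U0_ne_N2.symm E0_ne_N2.symm, add_zero, add_zero,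
    HexMidEdgeSAW.norm_weight _ hexCriticalFugacity_pos_lt_one.1.le]
  simp [HexMidEdgeSAW.length, γ₀]

/-! ### The 4-ball is a Euclidean ball, hence simply connected -/

/-- Nine times the squared distance from `c(V0)` is the integer form `P² + PQ + Q²`, `P = 3x₀ + i`, `Q = 3x₁ + i`. -/
theorem nine_mul_normSq (x : Site 2) (i : Fin 2) :
    9 * Complex.normSq (hexCenter (x, i) - hexCenter (((0 : Site 2)), (0 : Fin 2))) =
      (((3 * x 0 + (i : ℕ)) ^ 2 + (3 * x 0 + (i : ℕ)) * (3 * x 1 + (i : ℕ)) + (3 * x 1 + (i : ℕ)) ^ 2 : ℤ) : ℝ) := by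
  rw [hexCenter_sub_hexCenter, normSq_add_mul_triZeta]
  push_cast
  simp only [Pi.zero_apply, Int.cast_zero, sub_zero, CharP.cast_eq_zero]
  ring

/-- The integer form takes no value in `(3, 9)` on the two cosets, and its values `≤ 3` are attained exactly on
`Λ₄`: `P² + PQ + Q² ≤ 8` (`P = 3x₀+i`, `Q = 3x₁+i`) forces `(x, i) ∈ Λ₄`. -/
theorem mem_Λ₄_of_form_le (x : Site 2) (i : Fin 2)
    (h : (3 * x 0 + (i : ℕ)) ^ 2 + (3 * x 0 + (i : ℕ)) * (3 * x 1 + (i : ℕ)) + (3 * x 1 + (i : ℕ)) ^ 2 ≤ (8 : ℤ)) :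
    (x, i) ∈ Λ₄ := by
  have hmem : ∀ (y : Site 2) (j : Fin 2), x 0 = y 0 → x 1 = y 1 → i = j → (x, i) = (y, j) := by
    intro y j h0 h1 hij
    refine Prod.ext (funext fun k => ?_) hij
    fin_cases k
    · exact h0
    · exact h1
  have hi : ((i : ℕ) : ℤ) = 0 ∨ ((i : ℕ) : ℤ) = 1 := by
    rcases Fin.exists_fin_two.1 ⟨i, rfl⟩ with h | h <;> simp [h]
  -- `4(P² + PQ + Q²) = (P + 2Q)² + 3P²`, so `P² ≤ 32/3`, `|P| ≤ 3`; same for `Q`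
  have hP : -3 ≤ 3 * x 0 + ((i : ℕ) : ℤ) ∧ 3 * x 0 + ((i : ℕ) : ℤ) ≤ 3 := by
    constructor <;> nlinarith [sq_nonneg (3 * x 0 + ((i : ℕ) : ℤ) + 2 * (3 * x 1 + ((i : ℕ) : ℤ)))]
  have hQ : -3 ≤ 3 * x 1 + ((i : ℕ) : ℤ) ∧ 3 * x 1 + ((i : ℕ) : ℤ) ≤ 3 := by
    constructor <;> nlinarith [sq_nonneg (3 * x 1 + ((i : ℕ) : ℤ) + 2 * (3 * x 0 + ((i : ℕ) : ℤ)))]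
  have hx0 : x 0 = -1 ∨ x 0 = 0 ∨ x 0 = 1 := by omega
  have hx1 : x 1 = -1 ∨ x 1 = 0 ∨ x 1 = 1 := by omega
  simp only [Λ₄, Finset.mem_insert, Finset.mem_singleton]
  rcases hi with hi | hi
  · have hi0 : i = 0 := Fin.ext (by rw [Fin.val_zero]; exact_mod_cast hi)
    subst hi0
    rw [hi] at h
    rcases hx0 with h0 | h0 | h0 <;> rcases hx1 with h1 | h1 | h1 <;> rw [h0, h1] at h <;> norm_num at h
    exact Or.inl (hmem 0 0 (by simp [h0]) (by simp [h1]) rfl)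
  · have hi1 : i = 1 := Fin.ext (by rw [Fin.val_one]; exact_mod_cast hi)
    subst hi1
    rw [hi] at h
    rcases hx0 with h0 | h0 | h0 <;> rcases hx1 with h1 | h1 | h1 <;> rw [h0, h1] at h <;> norm_num at h
    · exact Or.inr (Or.inr (Or.inl (hmem _ 1 (by simp [h0]) (by simp [h1]) rfl)))
    · exact Or.inr (Or.inr (Or.inr (hmem _ 1 (by simp [h0]) (by simp [h1]) rfl)))
    · exact Or.inr (Or.inl (hmem 0 1 (by simp [h0]) (by simp [h1]) rfl))

/-- On `Λ₄` the form is `≤ 3` (values `0, 3, 3, 3`). -/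
theorem form_le_of_mem_Λ₄ {x : Site 2} {i : Fin 2} (h : (x, i) ∈ Λ₄) :
    (3 * x 0 + (i : ℕ)) ^ 2 + (3 * x 0 + (i : ℕ)) * (3 * x 1 + (i : ℕ)) + (3 * x 1 + (i : ℕ)) ^ 2 ≤ (3 : ℤ) := by
  simp only [Λ₄, Finset.mem_insert, Finset.mem_singleton, Prod.mk.injEq] at h
  rcases h with ⟨rfl, rfl⟩ | ⟨rfl, rfl⟩ | ⟨rfl, rfl⟩ | ⟨rfl, rfl⟩ <;> simp

/-- **`Λ₄` is the closed Euclidean ball of radius `1/√3` about `c(V0)`.** -/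
theorem mem_Λ₄_iff (w : HexVertex) :
    w ∈ Λ₄ ↔ dist (hexCenter w) (hexCenter (((0 : Site 2)), (0 : Fin 2))) ≤ (Real.sqrt 3)⁻¹ := by
  obtain ⟨x, i⟩ := w
  have hd : 0 ≤ dist (hexCenter (x, i)) (hexCenter (((0 : Site 2)), (0 : Fin 2))) := dist_nonneg
  have h3 : (0 : ℝ) < (Real.sqrt 3)⁻¹ := by positivity
  have hsq : ((Real.sqrt 3)⁻¹) ^ 2 = 3⁻¹ := by rw [inv_pow, Real.sq_sqrt (by norm_num : (0 : ℝ) ≤ 3)]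
  have key : dist (hexCenter (x, i)) (hexCenter (((0 : Site 2)), (0 : Fin 2))) ≤ (Real.sqrt 3)⁻¹ ↔
      9 * Complex.normSq (hexCenter (x, i) - hexCenter (((0 : Site 2)), (0 : Fin 2))) ≤ 3 := by
    rw [← abs_of_nonneg hd, ← abs_of_nonneg h3.le, ← sq_le_sq, dist_sq_eq_normSq, hsq]
    constructor <;> intro h <;> nlinarith
  rw [key, nine_mul_normSq]
  constructor
  · intro h; exact_mod_cast form_le_of_mem_Λ₄ h
  · intro h
    have h' : (3 * x 0 + (i : ℕ)) ^ 2 + (3 * x 0 + (i : ℕ)) * (3 * x 1 + (i : ℕ)) + (3 * x 1 + (i : ℕ)) ^ 2 ≤ (3 : ℤ) := by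
      exact_mod_cast h
    exact mem_Λ₄_of_form_le x i (by omega)

/-- **Nothing between the first two shells**: a vertex at distance `< 1` from `c(V0)` lies in `Λ₄` (the form has
no value in `(3, 9)`), so the witness configuration is `R`-deep for every `R < 1`. -/
theorem mem_Λ₄_of_dist_lt_one {w : HexVertex}
    (h : dist (hexCenter w) (hexCenter (((0 : Site 2)), (0 : Fin 2))) < 1) : w ∈ Λ₄ := by
  obtain ⟨x, i⟩ := w
  have hd : 0 ≤ dist (hexCenter (x, i)) (hexCenter (((0 : Site 2)), (0 : Fin 2))) := dist_nonneg
  have h9 : 9 * Complex.normSq (hexCenter (x, i) - hexCenter (((0 : Site 2)), (0 : Fin 2))) < 9 := by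
    rw [← dist_sq_eq_normSq]; nlinarith
  rw [nine_mul_normSq] at h9
  have h' : (3 * x 0 + (i : ℕ)) ^ 2 + (3 * x 0 + (i : ℕ)) * (3 * x 1 + (i : ℕ)) + (3 * x 1 + (i : ℕ)) ^ 2 < (9 : ℤ) := by
    exact_mod_cast h9
  exact mem_Λ₄_of_form_le x i (by omega)

/-- **`Λ₄` is simply connected**: its complement is the exterior `{w | 1/√3 < dist}` of a Euclidean ball,
preconnected by `exterior_preconnected`. -/
theorem Λ₄_simplyConnected : hexDomainSimplyConnected Λ₄ := by
  unfold hexDomainSimplyConnected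
  have hset : ((↑Λ₄ : Set HexVertex)ᶜ) =
      {w : HexVertex | (Real.sqrt 3)⁻¹ < dist (hexCenter w) (hexCenter (((0 : Site 2)), (0 : Fin 2)))} := by
    ext w
    simp only [Set.mem_compl_iff, Finset.mem_coe, Set.mem_setOf_eq, mem_Λ₄_iff, not_le]
  rw [hset]
  exact exterior_preconnected _ _

/-! ### The load-bearing statement -/

/-- `ArrivalFlattening` with the depth hypothesis "the `R`-ball of `v` lies in `Λ`" DELETED (then `R` plays no
role and disappears). [folklore] -/
def ArrivalFlatteningWithoutDepth : Prop :=
  ∀ ε : ℝ, 0 < ε → ∀ (Λ : Finset HexVertex), hexDomainSimplyConnected Λ → ∀ a ∈ hexDomainBoundary Λ,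
    ∀ v ∈ Λ, ∀ w₀ w₁ w₂ : HexVertex, hexGraph.Adj v w₀ → hexGraph.Adj v w₁ → hexGraph.Adj v w₂ →
    w₀ ≠ w₁ → w₁ ≠ w₂ → w₀ ≠ w₂ →
    ‖arrivalTransform Λ a v w₀ w₁ w₂ (11 / 8)‖ ≤ ε * ‖arrivalTransform Λ a v w₀ w₁ w₂ (5 / 8)‖

/-- **The flattening inequality fails on the 4-ball for every `ε < 1`** (both sides have modulus `x_c`). -/
theorem not_flat_Λ₄ {ε : ℝ} (hε : ε < 1) :
    ¬ (‖arrivalTransform Λ₄ s(E0, (((0 : Site 2)), (1 : Fin 2))) (((0 : Site 2)), (0 : Fin 2))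
        (((0 : Site 2)), (1 : Fin 2)) ((-(Pi.single 0 1 : Site 2)), (1 : Fin 2)) ((-(Pi.single 1 1 : Site 2)), (1 : Fin 2)) (11 / 8)‖ ≤
      ε * ‖arrivalTransform Λ₄ s(E0, (((0 : Site 2)), (1 : Fin 2))) (((0 : Site 2)), (0 : Fin 2))
        (((0 : Site 2)), (1 : Fin 2)) ((-(Pi.single 0 1 : Site 2)), (1 : Fin 2)) ((-(Pi.single 1 1 : Site 2)), (1 : Fin 2)) (5 / 8)‖) := by
  rw [norm_arrivalTransform_Λ₄, norm_arrivalTransform_Λ₄]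
  intro h
  have hx := hexCriticalFugacity_pos_lt_one.1
  nlinarith

/-- **The depth hypothesis of `ArrivalFlattening` is load-bearing**: with the `R`-ball hypothesis deleted the
statement is false (witness `ε = 1/2`, `Λ₄`, root `{E0, U0}`, `v = V0`, ports `(U0, N1, N2)`: one walk, ratio `1`).
Any proof must use that `v` is deep. [folklore] -/
theorem arrivalFlattening_false_without_depth : ¬ ArrivalFlatteningWithoutDepth := by
  intro h
  exact not_flat_Λ₄ (by norm_num : (1 / 2 : ℝ) < 1)
    (h (1 / 2) (by norm_num) Λ₄ Λ₄_simplyConnected _ root_mem_boundary (((0 : Site 2)), (0 : Fin 2)) (by simp [Λ₄])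
      _ _ _ nfb_adj_V0_U0 nfb_adj_V0_N1 nfb_adj_V0_N2 nfb_U0_ne_N1 nfb_N2_ne_N1.symm nfb_U0_ne_N2)

/-- **Depth tightness `R(ε) ≥ 1`**: for `ε < 1` no `R < 1` is admissible in the crux — the 4-ball witness is
`R`-deep for every `R < 1` (`mem_Λ₄_of_dist_lt_one`). [folklore] -/
theorem not_atDepth_of_lt_one {ε R : ℝ} (hε : ε < 1) (hR : R < 1) :
    ¬ AtDepth R (fun Λ a v w₀ w₁ w₂ =>
      ‖arrivalTransform Λ a v w₀ w₁ w₂ (11 / 8)‖ ≤ ε * ‖arrivalTransform Λ a v w₀ w₁ w₂ (5 / 8)‖) := by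
  intro h
  refine not_flat_Λ₄ hε (h Λ₄ Λ₄_simplyConnected _ root_mem_boundary (((0 : Site 2)), (0 : Fin 2)) (by simp [Λ₄])
    (fun w hw => mem_Λ₄_of_dist_lt_one (hw.trans_lt hR))
    _ _ _ nfb_adj_V0_U0 nfb_adj_V0_N1 nfb_adj_V0_N2 nfb_U0_ne_N1 nfb_N2_ne_N1.symm nfb_U0_ne_N2)

/-- Corollary: in `ArrivalFlattening` every depth admissible for some `ε < 1` is at least `1`. [folklore] -/
theorem one_le_of_atDepth {ε R : ℝ} (hε : ε < 1)
    (h : AtDepth R (fun Λ a v w₀ w₁ w₂ =>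
      ‖arrivalTransform Λ a v w₀ w₁ w₂ (11 / 8)‖ ≤ ε * ‖arrivalTransform Λ a v w₀ w₁ w₂ (5 / 8)‖)) : 1 ≤ R :=
  not_lt.1 fun hR => not_atDepth_of_lt_one hε hR h

/-- The portwise strengthening is false already because its vanishing form fails for `R < 1` on the 4-ball
(the port `U0` carries the walk `[U0]`, of non-zero weight). [folklore] -/
theorem not_portwise_of_lt_one {R : ℝ} (hR : R < 1) :
    ¬ AtDepth R (fun Λ a v w₀ _ _ =>
      hexParafermionicObservable (Λ.erase v) a hexCriticalFugacity (5 / 8) s(v, w₀) = 0) := by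
  intro h
  have key := h Λ₄ Λ₄_simplyConnected _ root_mem_boundary (((0 : Site 2)), (0 : Fin 2)) (by simp [Λ₄])
    (fun w hw => mem_Λ₄_of_dist_lt_one (hw.trans_lt hR))
    _ _ _ nfb_adj_V0_U0 nfb_adj_V0_N1 nfb_adj_V0_N2 nfb_U0_ne_N1 nfb_N2_ne_N1.symm nfb_U0_ne_N2
  dsimp only at key
  rw [erase_V0, obs_port_U0] at key
  have hn := congrArg (fun z : ℂ => ‖z‖) key
  simp only [HexMidEdgeSAW.norm_weight _ hexCriticalFugacity_pos_lt_one.1.le, norm_zero] at hn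
  simp [HexMidEdgeSAW.length, γ₀, hexCriticalFugacity_pos_lt_one.1.ne'] at hn

/-! ## §2 Quantifier order: `∀ Λ ∀ a ∃ R` is vacuous -/

/-- **The non-uniform form is trivially TRUE**: if `R` may depend on the domain (and the root), choose it so large
that no vertex is `R`-deep — `R := Σ_{w ∈ Λ} dist(c u, c w)` with `u ∉ Λ` the outer end of the root. All content of
the crux is in the order `∃ R ∀ Λ`. [folklore] -/
theorem arrivalFlatteningNonUniform_holds :
    ∀ ε : ℝ, 0 < ε → ∀ (Λ : Finset HexVertex), hexDomainSimplyConnected Λ → ∀ a ∈ hexDomainBoundary Λ,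
      ∃ R : ℝ, ∀ v ∈ Λ, (∀ w : HexVertex, dist (hexCenter w) (hexCenter v) ≤ R → w ∈ Λ) →
      ∀ w₀ w₁ w₂ : HexVertex, hexGraph.Adj v w₀ → hexGraph.Adj v w₁ → hexGraph.Adj v w₂ →
      w₀ ≠ w₁ → w₁ ≠ w₂ → w₀ ≠ w₂ →
      ‖arrivalTransform Λ a v w₀ w₁ w₂ (11 / 8)‖ ≤ ε * ‖arrivalTransform Λ a v w₀ w₁ w₂ (5 / 8)‖ := by
  intro ε _ Λ _ a ha
  obtain ⟨-, u, w₁, rfl, -, hu⟩ := ha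
  refine ⟨∑ w ∈ Λ, dist (hexCenter u) (hexCenter w), fun v hv hball => ?_⟩
  exfalso
  exact hu (hball u (Finset.single_le_sum (f := fun w => dist (hexCenter u) (hexCenter w))
    (fun w _ => dist_nonneg) hv))

/-! ## §4 Simple connectivity is load-bearing: the PINCER (exact numerics; mechanism; no finite Lean witness)

`hexDomainSimplyConnected Λ` cannot be dropped. Numerics (this seat, exact transfer matrix `hextm`, folder
`exp/holed2.py`, `exp/pincer.py`): take the punctured ball `B_R(v)` and feed it from a hub `H` on the left
(root = left half-edge of `H`) through TWO width-1 corridors of equal length, one passing OVER the ball to the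
mouth at polar angle `60°`, one UNDER it to the mouth at `300°` (a pincer; the region between the arms and the
ball is a hole, so `Λ` is not simply connected; `v` is still `R`-deep). The two access routes differ in
accumulated winding by `240°`; their in-ball continuations are mirror images. Result:

  depth 1.53 (ball R_t = 1.16, arms 13/15):  r = |A(11/8)|/|A(5/8)| = 1.010  (ball alone 0.6087)
  depth 2.08 (R_t = 2.00, arms 17/17):       r = 2.2301  = (2+√3)·0.5976   (ball alone 0.5976), m = 0.19, FM order violated
  depth 2.31 (R_t = 2.09, arms 17/19):       r = 0.6404  (ball alone 0.3859)
  depth 1.73 (R_t = 1.53, arms 15/15):       r = 2.2717  = (2+√3)·0.6087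

With EQUAL arms the amplification is EXACTLY `cot 15° = 2 + √3 = 3.7321` (two equal-weight branches with relative
winding `ΔW = 240°`: `|1 + e^{-i(11/8)·240°}| / |1 + e^{-i(5/8)·240°}| = |1 + e^{i30°}| / |1 + e^{-i150°}| =
2cos 15° / 2sin 15°`); with arm mismatch `Δℓ = 2` (relative weight `x_c² = 0.29`) it is `1.66`. So WITHOUT simple
connectivity the inequality is REVERSED (`r > 1`) at depths `1.7–2.1`, and stays `> 1` as long as the one-mouth
ratio exceeds `1/(2+√3) = 0.268`, i.e. (ball table of j023283: `0.32` at `R = 4.04`) up to depth `≈ 5`.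
Which branch pairs amplify: `ΔW = 2π` gives factor EXACTLY `1` (`|1+e^{-i·495°}| = |1+e^{-i·225°}|`: a single
hole that is merely circled is spin-blind — the reason the naive "two sheets" attack fails); `ΔW = ±120°`
suppresses (`|1+te^{∓i165°}|/|1+te^{∓i75°}| < 1`); `ΔW = ±240°` amplifies (`≤ 2+√3`). For the ε–R statement at
EVERY ε one needs amplification growing with `R`: phased arrays of ≥ 3 corridors with branch weights tuned by
sub-branch multiplicities (weights are sums of powers of `x_c`, lengths `O(log R)` suffice) can make `|A(5/8)|`
small against `|A(11/8)|` — plausible, not computed; an EXACT zero is impossible in any domain (Galois, rattack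
seat: `A(11/8) = σ₃₁(A(5/8))` in `ℚ(ζ₄₈)`, `σ₃₁` fixing `x_c`). Topological constraint used by SC: pairwise
disjoint corridors from one outer region to the ball have windings in an open window of width `< 360°`, and in a
simply connected `Λ ⊇ B_R(v)` two routes with different windings bound a FILLED region feeding every intermediate
entrance angle — uniform feeding over an arc `Φ ≤ 360°` never amplifies (`|sin(11Φ/16)|/|sin(5Φ/16)|·5/11 ≤ 1`).
CONSEQUENCE FOR PROVERS: any proof must use `hexDomainSimplyConnected` to exclude two macroscopically distinct
access routes to the ball (not merely through DCS Lemma 1, which holds verbatim in the pincer).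
No Lean statement is recorded for §4: a refutation "without SC" needs a witness at every depth (a family), and the
pincer observable is not hand-computable. -/

/-! ## §5 Line `spin-chord` (lead prover-line-stmt-CriticalPhenomena-16770-0): stub-level findings

Registered stubs (Defs module `…SpinChordDefs`, landed p165751): S1 `ThreeSpinChord` (∃ K > 0, R₁: AtDepth R₁
(‖A(11/8)‖·‖A(0)‖^K ≤ ‖A(5/8)‖^{1+K})), S2 `SpinMonotonePair` (∃ R₂: ‖A(5/8)‖ ≤ ‖A(3/8)‖), S3 `ExitSpinBound`
(LANDED p166590), S4 `ThroughMassDecay` (∀ η ∃ R: ThroughMass ≤ η‖A(0)‖). Joint sufficiency is kernel-checked in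
the skeleton (`ArrivalFlattening_of`), so only the stubs themselves are attackable.

* S1. TIGHT WITH EQUALITY on one-walk laws: `chord_eq_on_Λ₄` below (‖A(s)‖ = x_c for all s, so both sides are
  `x_c^{1+K}` for EVERY real K) — the chord carries no information at the depth-free witness, consistent with
  `∃ K`. The only law shape that breaks the chord for every `K > 0` is single-PORT multi-SHEET (`r = 1`, `m < 1`);
  in a simply connected `Λ` a second sheet at a port needs a cycle of `Λ.erase v` around `v`, whose inside is then
  entirely in `Λ` (no holes), so all three ports are fed from the same disc: single-port two-sheet laws do not occur
  in the crux's class (they do in holed domains: the pincer of §4 has `r > 1`, i.e. `K < 0`). Numerically (table):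
  the largest admissible exponent `K* = log r / log m` per configuration has `inf K* = 1.283` (off-centre deep
  vertex, depth 2.08, root (-3,-1)) and its depth-envelope INCREASES (`1.28, 1.38, 1.46, 1.48, 1.63` at
  `D = 2.08, 2.31, 2.65, 3.21, 3.79`); the chord with `K = 1` (`‖A(11/8)‖‖A(0)‖ ≤ ‖A(5/8)‖²`) and with `K = 1.25`
  holds in 219/219 configurations. S1 looks safe for any `K ≤ 1.25`, `R₁ ≈ 1.5`.
* S2. Spin-monotone order `A(0) ≥ ‖A(3/8)‖ ≥ ‖A(5/8)‖ ≥ ‖A(11/8)‖ ≥ ‖A(3/2)‖`: 0 violations in 219 simply connected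
  configurations; violated in the pincer (holed) — as expected, SpinMonotone itself needs SC.
* S3 (landed): `‖A(3/8)‖/ThroughMass ∈ [0.720, 0.892]` over the 197 configurations with `N ≤ 142` (slack ≥ 11%).
* S4 (hardest). The stub is a SUP over roots and far fields at fixed depth (the line card quotes medians over roots
  on balls). Envelope `sup {ThroughMass/A(0) : depth ≥ D}`: `1.192 (1.53), 1.106 (1.73–2.08), 1.036 (2.31–2.65),
  0.994 (2.89), 0.957 (3.21), 0.948 (3.51), 0.929 (4.00), 0.921 (4.16–4.36)`; fit over balls of depth ≥ 2:
  `≈ 1.25 D^{-0.22}` (predicted `R^{-9/48} = R^{-0.19}`). Far fields raise the sup only at the smallest depth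
  (off-centre 1.192, slit-tip 1.178 vs ball 1.046 at `D = 1.53`); from `D = 2.5` on needle / slit / off-centre values
  sit at or below the ball values (`0.93–1.03`). So the sup decays, slowly and monotonically in this range; a plateau
  cannot be excluded by numerics to depth 4.4, and no amplifying simply connected far field was found.

  j026734 table (exact transfer matrix; `r = ‖A(11/8)‖/‖A(5/8)‖`, `m = ‖A(5/8)‖/A(0)`, `K* = log r/log m`,
  `TM = ThroughMass/A(0)`; sup / inf over all LEFT boundary roots of each design; depth in centre-spacing units):

    family      depth   n   sup r   (root)    inf K*  sup m    sup TM   inf a38/TM  order-viol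
    ball        1.528   3   0.6087  (-2, 0)   1.900   0.7700   1.0460   0.861       0
    ball        1.732   5   0.6087  ( 1, 2)   1.900   0.7700   1.1058   0.811       0
    ball        2.082   7   0.6011  (-3,-1)   1.609   0.7338   1.1056   0.786       0
    ball        2.309   5   0.4977  (-3,-1)   1.608   0.6478   0.9861   0.854       0
    ball        2.646   8   0.4977  (-4,-1)   1.608   0.6478   1.0359   0.812       0
    ball        2.887   8   0.4366  (-5,-1)   1.649   0.6050   0.9939   0.818       0
    ball        3.055   9   0.4183  (-4,-2)   1.654   0.5903   0.9921   0.815       0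
    ball        3.215   7   0.3764  (-4,-2)   1.673   0.5576   0.9331   0.852       0
    ball        3.464   9   0.3764  (-1, 4)   1.673   0.5576   0.9570   0.829       0
    ball        3.512   9   0.3769  (-6,-2)   1.630   0.5506   0.9483   0.831       0
    ball        3.786  11   0.3562  (-6,-2)   1.629   0.5305   0.9464   0.816       0
    ball        4.000   9   0.3385  (-6,-2)   1.629   0.5143   0.9113   0.844       0
    ball        4.042  11   0.3385  (-6,-2)   1.629   0.5143   0.9289   0.828       0
    ball        4.163  10   0.3225  ( 0, 5)   1.629   0.4992   0.9033   0.843       0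
    ball        4.359  12   0.3225  ( 0, 5)   1.629   0.4992   0.9213   0.826       0
    needle-far  1.528  10   0.5002  (-4,-1)   1.802   0.6807   1.0279   0.820       0
    needle-far  2.517  20   0.4172  (-5,-1)   1.695   0.5970   0.9958   0.819       0
    needle-far  3.512  10   0.3157  (-5,-3)   1.694   0.5153   0.9298   0.829       0
    offcentre   1.528  12   0.5999  (-2, 0)   1.358   0.7119   1.1918   0.720       0
    offcentre   2.082  12   0.5372  (-3,-1)   1.283   0.6386   1.0959   0.742       0
    offcentre   2.517  12   0.4628  (-4,-1)   1.380   0.5843   1.0286   0.780       0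
    offcentre   3.055   6   0.4022  (-5,-1)   1.464   0.5369   0.9899   0.786       0
    offcentre   3.512   6   0.3658  (-6,-1)   1.478   0.5064   -        -           0
    slit-tip    1.528   2   0.5577  (-2, 0)   1.471   0.7023   1.1781   0.720       0
    slit-tip    2.517   4   0.3497  (-4, 0)   1.814   0.5911   1.0293   0.757       0
    slit-tip    3.512   2   0.2535  (-6, 0)   1.986   0.5105   0.9434   0.805       0

  (designs: `ball` = Euclidean ball `B_D(v)`; `needle-far` = ball of radius `D + extra` minus a radial needle of
  removed vertices ending just outside `B_D(v)`; `offcentre` = `v` at depth exactly `D` inside a larger ball,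
  all roots; `slit-tip` = ball plus a straight slit whose tip is the root, at distance `≈ D` from `v`.
  Envelope of the crux ratio: `sup {r : depth ≥ D} = 0.609, 0.601, 0.498, 0.437, 0.418, 0.377, 0.356, 0.339, 0.322`
  at `D = 1.53, 2.08, 2.31, 2.89, 3.06, 3.21, 3.79, 4.00, 4.16` — monotone, and the far-field families never
  exceed the ball sup of the same depth.)
* Sup-form caveat for S4 recorded by the strategist (escape mass from a straight slit tip grows like R^{1/16}) is
  about the γ-wise sup, not the stub; nothing to add. -/

/-- **S1 is tight with equality on the 4-ball**: `‖A(11/8)‖·‖A(0)‖^K = ‖A(5/8)‖^{1+K}` for EVERY real `K`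
(all three moduli equal `x_c`). [folklore] -/
theorem chord_eq_on_Λ₄ (K : ℝ) :
    ‖arrivalTransform Λ₄ s(E0, (((0 : Site 2)), (1 : Fin 2))) (((0 : Site 2)), (0 : Fin 2))
        (((0 : Site 2)), (1 : Fin 2)) ((-(Pi.single 0 1 : Site 2)), (1 : Fin 2)) ((-(Pi.single 1 1 : Site 2)), (1 : Fin 2)) (11 / 8)‖ *
      ‖arrivalTransform Λ₄ s(E0, (((0 : Site 2)), (1 : Fin 2))) (((0 : Site 2)), (0 : Fin 2))
        (((0 : Site 2)), (1 : Fin 2)) ((-(Pi.single 0 1 : Site 2)), (1 : Fin 2)) ((-(Pi.single 1 1 : Site 2)), (1 : Fin 2)) 0‖ ^ K =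
      ‖arrivalTransform Λ₄ s(E0, (((0 : Site 2)), (1 : Fin 2))) (((0 : Site 2)), (0 : Fin 2))
        (((0 : Site 2)), (1 : Fin 2)) ((-(Pi.single 0 1 : Site 2)), (1 : Fin 2)) ((-(Pi.single 1 1 : Site 2)), (1 : Fin 2)) (5 / 8)‖ ^ (1 + K) := by
  rw [norm_arrivalTransform_Λ₄, norm_arrivalTransform_Λ₄, norm_arrivalTransform_Λ₄,
    Real.rpow_add hexCriticalFugacity_pos_lt_one.1, Real.rpow_one]

end Summit.CriticalPhenomena.SAWScalingLimit.Cruxes.ArrivalFlattening.Disproof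

end
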